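import Mathlib
import Summits.BirchSwinnertonDyer.BirchSwinnertonDyer.Theorems.ResidualThetaTransportAtTwoSignedMuSeedAtTwoPlusNonsquareDescentGrowthLinear
import Summits.BirchSwinnertonDyer.BirchSwinnertonDyer.Theorems.ResidualThetaTransportAtTwoSignedMuSeedAtTwoPlusNonsquareDescentMuCriterion
import HarnessLib

/-!
# Non-square descent — THE INDEX SPLIT `#B'_n = [𝓔_n^χ : 𝒩_n] · [𝒩_n : 𝒪[G_n]u_n]` WITH `[𝒩_n : 𝒪[G_n]u_n] ∣ #(Q'/ω_nQ')` (the ALGEBRAIC half of the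
# Herbrand/capitulation bound `#B'_n ≤ #F^χ · #(Q'/ω_nQ')` of stub S2) — seed crux `SignedMuSeedAtTwoPlus` stmt-BirchSwinnertonDyer-21438 (parent Kμ⁺
# `SignedMuVanishingAtTwoPlus` stmt-BirchSwinnertonDyer-20689, route ResidualThetaTransportAtTwo), line card `Cruxes/SignedMuSeedAtTwoPlus/Lines/nonsquare-descent.md`

Cell `bsd-wall`, width seat `bsd-wall-rtt-p4-w2` g18 (`--supports`, closes nothing).  THEOREMS ONLY; BSD is not proved by this and
nothing arithmetic is asserted: module algebra over a commutative ring.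

Stub S2 bounds `#B'_n = [𝓔_n^χ : 𝒪[G_n]u_n]` by `#F^χ · #(Q'/ω_nQ')` («Herbrand quotient 1 on χ-parts, … capitulation `≤ #F^χ`»).  Writing `π_n : Ē^χ → 𝓔_n^χ`
for the projection of the norm-coherent limit (image `𝒩_n` = universal norms; `π_n(ω_n x) = 0` since `γ^{pⁿ}` acts trivially at level `n`;
`π_n(u_∞) = u_n`), the bound SPLITS: `#B'_n = [𝓔_n^χ : 𝒩_n] · [𝒩_n : ⟨u_n⟩]` and `[𝒩_n : ⟨u_n⟩]` is the order of a QUOTIENT of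
`Ē^χ/(Λ'u_∞ + ω_nĒ^χ) = Q'/ω_nQ'`.  Only `[𝓔_n^χ : 𝒩_n] ≤ #F^χ` («units modulo universal norms», Herbrand/capitulation) is arithmetic.  This file
proves the split for any `R`-linear `π : E_∞ → E_n` killing `ω • E_∞` and any `u ∈ E_∞`:

* `natCard_quotient_span_eq_mul` — `#(E_n/⟨πu⟩) = #(E_n/range π) · #(range π / ⟨πu⟩)` (`natCard_quotient_eq_mul` of `…GrowthLinear`).
* `liftQ_surjective_of_proj` — `E_∞/(⟨u⟩ + ωE_∞) ↠ range π/⟨πu⟩`; `natCard_range_quotient_dvd` — hence `#(range π/⟨πu⟩) ∣ #(E_∞/(⟨u⟩ + ωE_∞))`.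
* **`natCard_quotient_span_proj_dvd`** — `#(E_n/⟨πu⟩) ∣ #(E_n/range π) · #(E_∞/(⟨u⟩ + ωE_∞))`, and with g17's
  `nonempty_quotient_quotient_linearEquiv`: **`natCard_quotient_span_proj_dvd'`** — `#B'_n ∣ [E_n : 𝒩_n] · #(Q'/ωQ')` where `Q' = E_∞/⟨u⟩`
  (`Nat.card` throughout, unconditionally: no finiteness hypotheses).

[folklore]
-/

set_option autoImplicit false
-- the Theorems namespace of this sub repeats the summit name by design (D-0017 nested layout)
set_option linter.dupNamespace false

open scoped Pointwise

namespace Summit.BirchSwinnertonDyer.BirchSwinnertonDyer.Theorems.SignedMuAtTwo.NonsquareDescent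

section IndexSplit

variable {R : Type*} [CommRing R] {Einf : Type*} [AddCommGroup Einf] [Module R Einf]
  {En : Type*} [AddCommGroup En] [Module R En]

/-- `⟨π u⟩ ≤ range π`. [folklore] -/
theorem span_proj_le_range (π : Einf →ₗ[R] En) (u : Einf) :
    Submodule.span R {π u} ≤ LinearMap.range π := by
  rw [Submodule.span_singleton_le_iff_mem]
  exact LinearMap.mem_range_self π u

/-- **`#(E_n/⟨πu⟩) = #(range π/⟨πu⟩) · #(E_n/range π)`** (`#B'_n = [𝒩_n : ⟨u_n⟩] · [𝓔_n^χ : 𝒩_n]`). [folklore] -/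
theorem natCard_quotient_span_eq_mul (π : Einf →ₗ[R] En) (u : Einf) :
    Nat.card (En ⧸ Submodule.span R {π u}) =
      Nat.card (↥(LinearMap.range π) ⧸ (Submodule.span R {π u}).comap (LinearMap.range π).subtype) *
        Nat.card (En ⧸ LinearMap.range π) :=
  natCard_quotient_eq_mul _ _ (span_proj_le_range π u)

/-- The map `E_∞ → range π / ⟨πu⟩` kills `⟨u⟩ + ω E_∞` when `π` kills `ω E_∞`. [folklore] -/
theorem span_sup_smul_le_ker (π : Einf →ₗ[R] En) {ω : R} (hω : ∀ x : Einf, π (ω • x) = 0) (u : Einf) :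
    Submodule.span R {u} ⊔ ω • (⊤ : Submodule R Einf) ≤
      LinearMap.ker (((Submodule.span R {π u}).comap (LinearMap.range π).subtype).mkQ.comp π.rangeRestrict) := by
  refine sup_le ?_ ?_
  · rw [Submodule.span_singleton_le_iff_mem, LinearMap.mem_ker, LinearMap.comp_apply, Submodule.mkQ_apply,
      Submodule.Quotient.mk_eq_zero, Submodule.mem_comap]
    exact Submodule.mem_span_singleton_self _
  · intro x hx
    rw [Submodule.mem_smul_pointwise_iff_exists] at hx
    obtain ⟨y, -, rfl⟩ := hx
    rw [LinearMap.mem_ker, LinearMap.comp_apply, Submodule.mkQ_apply, Submodule.Quotient.mk_eq_zero, Submodule.mem_comap]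
    have h0 : ((π.rangeRestrict (ω • y) : ↥(LinearMap.range π)) : En) = 0 := by
      rw [LinearMap.codRestrict_apply, hω]
    have h1 : π.rangeRestrict (ω • y) = 0 := Subtype.ext h0
    rw [h1]
    exact Submodule.zero_mem _

/-- **`E_∞/(⟨u⟩ + ωE_∞) ↠ range π/⟨πu⟩`** (`Q'/ω_nQ' ↠ 𝒩_n/⟨u_n⟩`). [folklore] -/
theorem liftQ_surjective_of_proj (π : Einf →ₗ[R] En) {ω : R} (hω : ∀ x : Einf, π (ω • x) = 0) (u : Einf) :
    Function.Surjective
      ((Submodule.span R {u} ⊔ ω • (⊤ : Submodule R Einf)).liftQ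
        (((Submodule.span R {π u}).comap (LinearMap.range π).subtype).mkQ.comp π.rangeRestrict)
        (span_sup_smul_le_ker π hω u)) := by
  intro q
  obtain ⟨z, rfl⟩ := Submodule.mkQ_surjective _ q
  obtain ⟨x, hx⟩ := LinearMap.surjective_rangeRestrict π z
  exact ⟨Submodule.Quotient.mk x, by rw [Submodule.liftQ_apply, LinearMap.comp_apply, hx]⟩

/-- Hence **`#(range π/⟨πu⟩) ∣ #(E_∞/(⟨u⟩ + ωE_∞))`**. [folklore] -/
theorem natCard_range_quotient_dvd (π : Einf →ₗ[R] En) {ω : R} (hω : ∀ x : Einf, π (ω • x) = 0) (u : Einf) :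
    Nat.card (↥(LinearMap.range π) ⧸ (Submodule.span R {π u}).comap (LinearMap.range π).subtype) ∣
      Nat.card (Einf ⧸ (Submodule.span R {u} ⊔ ω • (⊤ : Submodule R Einf))) :=
  AddSubgroup.card_dvd_of_surjective
    ((Submodule.span R {u} ⊔ ω • (⊤ : Submodule R Einf)).liftQ _ (span_sup_smul_le_ker π hω u)).toAddMonoidHom
    (liftQ_surjective_of_proj π hω u)

/-- **THE INDEX SPLIT: `#(E_n/⟨πu⟩) ∣ #(E_n/range π) · #(E_∞/(⟨u⟩ + ωE_∞))`** — `#B'_n ∣ [𝓔_n^χ : 𝒩_n] · #(Ē^χ/(Λ'u_∞ + ω_nĒ^χ))`; only the first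
factor («units modulo universal norms») is arithmetic. [folklore] -/
theorem natCard_quotient_span_proj_dvd (π : Einf →ₗ[R] En) {ω : R} (hω : ∀ x : Einf, π (ω • x) = 0) (u : Einf) :
    Nat.card (En ⧸ Submodule.span R {π u}) ∣
      Nat.card (En ⧸ LinearMap.range π) * Nat.card (Einf ⧸ (Submodule.span R {u} ⊔ ω • (⊤ : Submodule R Einf))) := by
  rw [natCard_quotient_span_eq_mul, mul_comm]
  exact mul_dvd_mul_left _ (natCard_range_quotient_dvd π hω u)

/-- The same with the second factor written as `#(Q'/ωQ')`, `Q' = E_∞/⟨u⟩` (g17's `nonempty_quotient_quotient_linearEquiv`):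
**`#B'_n ∣ [𝓔_n^χ : 𝒩_n] · #(Q'/ω_nQ')`**. [folklore] -/
theorem natCard_quotient_span_proj_dvd' (π : Einf →ₗ[R] En) {ω : R} (hω : ∀ x : Einf, π (ω • x) = 0) (u : Einf) :
    Nat.card (En ⧸ Submodule.span R {π u}) ∣
      Nat.card (En ⧸ LinearMap.range π) *
        Nat.card ((Einf ⧸ Submodule.span R {u}) ⧸ (ω • (⊤ : Submodule R (Einf ⧸ Submodule.span R {u})))) := by
  obtain ⟨e⟩ := nonempty_quotient_quotient_linearEquiv (R := R) (E := Einf) u ω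
  rw [Nat.card_congr e.toEquiv]
  exact natCard_quotient_span_proj_dvd π hω u

end IndexSplit

end Summit.BirchSwinnertonDyer.BirchSwinnertonDyer.Theorems.SignedMuAtTwo.NonsquareDescent
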